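import Summits.QuantumFields.BalabanUV.T4Continuum.E3Cert.ZL2d2AllU.Main
import Literature.MathematicalPhysics.QuantumFieldTheory.Balaban1983to89.B4GaugeCovariance

/-!
# Gaps / E3BlockL2d2Dictionary — the TREE-SIDE DICTIONARY for the smallest E3 certificate: the lane polynomial
# `E3Z.zL2d2AllU_quadH` IS `2²⁰ · ⟨Φ, covOp Φ⟩` for the tree's covariant block operator `B4GaugeCovariance.covOp` ([B4] (1.3)–(1.6)) on the
# 2 × 2 block, so the kernel certificate `E3Z.zL2d2AllU_nonneg` reads: `−Δ_W + 4·P ≥ (1021/1024)·1` on ONE (d, L, k) = (2, 2, 1) block for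
# EVERY SU(2) ≅ S³ link configuration in the corner-tree gauge (quaternion model, fundamental action on ℍ = ℝ⁴)

HONEST FRAMING (cell pub-balaban-gaps, seat g1-p3; page 1 of everything): certified finite arithmetic on ONE small block in d = 2, in the E3
lane's scalar-charged quaternion SURROGATE of Bałaban's covariant block operator ([Balaban1983RegularityDecay] = B4, CMP **89** (1983), p. 572
(1.3)–(1.6); target shape (1.8) p. 573).  What this module adds is ONLY the identification, open since the E3 packages landed (their own docstrings:
«Tree-side dictionary «this H IS Bałaban's −Δ_U + aP(U) on the block» is a separate statement»), between the lane's opaque integer polynomial and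
the tree's typed operator `covOp c m² a q W T = covLap c W + m²·1 + a·projOp q T` (B4GaugeCovariance.lean :434) — for THIS package.  It is NOT
Prop. (1.8) (no Ω-assembly beyond the Neumann-decoupling remark, no k-tower, d = 2 only), NOT an input of any NE row today, NOT continuum, NOT Clay.

THE DICTIONARY (E3 conventions v0, `harness/engines/ttrl/bal_e3_lattice.py` docstring; lane README «DICTIONARY» paragraph): sites of the 2 × 2 block
`X = Fin 4` in lexicographic order `0 = (0,0), 1 = (0,1), 2 = (1,0), 3 = (1,1)`; field components `ι = Fin 4` (ℍ = ℝ⁴, basis 1, i, j, k); ONE coarse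
site `Y = Unit`.  Bond weights `c x y = η⁻² = 4` on the four positively oriented in-block bonds `(b₋, b₊) ∈ {(0,2), (0,1), (1,3), (2,3)}` (Neumann:
nothing else), `cL2`.  Link variables `W x y`: the identity on the three corner-taxi TREE bonds `(0,2), (0,1), (2,3)` (tree gauge) and LEFT
multiplication `Lq u` by the free link's quaternion `u = (X 0, …, X 3)` on the one non-tree bond `(1,3)` ([B4] (1.3): `|U(A_b)φ(b₊) − φ(b₋)|²` =
`|W x y φ(y) − φ(x)|²`, `covLap_form`), `WL2`.  Averaging weights `q _ x = η^d = 1/4`, transporters `T _ x = 1` (paths run along tree bonds), `qL2`,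
`TL2`; `m² = 0`; `a′ = a·η^{−d} = 4` (the η^d-weights of the printed L² pairing absorbed into `q` and `a`, as `projOp`'s own docstring says).  Test
field `Φ (s, c) = X (4 + 4s + c)` (`fieldOf`).  THEOREM `quadH_eq_covOp_form`: `Poly.eval X zL2d2AllU_quadH = 2²⁰ · Φ ⬝ᵥ (covOp cL2 0 4 qL2 (WL2 u) TL2 *ᵥ Φ)`
for EVERY real assignment `X` (a polynomial identity in 20 variables, 72 monomials; `|u|²` is symbolic on both sides; checked outside the kernel at 20
random integer points against the tree literal, seat folder `work/dict/check_L2d2.py`).  COROLLARY `covOp_coercive_L2d2`: for every `u` on the unit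
sphere S³ and every field `Φ`, `(1021/1024)·(Φ ⬝ᵥ Φ) ≤ Φ ⬝ᵥ (covOp … *ᵥ Φ)` — the tree-currency reading of the kernel certificate `E3Z.zL2d2AllU_nonneg`
(CENSUS-TABLE row «(2,2,1) ALL of SU(2) CERT», γ ≥ 499/500 there; 1021/1024 in the dyadic tree package).  Contrast (same seat,
`Gaps/E3BlockD4VortexWitness`): in d = 4 the all-U analogue FAILS (ℤ₂ vortex, quotient ≤ 0.60845).
-/

namespace Summit.QuantumFields.BalabanUV.Gaps.E3BlockL2d2Dictionary

open E3Z
open scoped Matrix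
open Literature.MathematicalPhysics.QuantumFieldTheory.Balaban1983to89.B4GaugeCovariance

noncomputable section

/-! ## §1 The (2,2,1) block data in the tree's vocabulary -/

/-- bond weights of the 2 × 2 Neumann block: `η⁻² = 4` on the ordered nearest-neighbour pairs `(b₋, b₊) = (0,2), (0,1), (1,3), (2,3)`
(sites in lexicographic order), `0` otherwise. [cite: Balaban1983RegularityDecay, p. 572 (1.3)] -/
def cL2 : Fin 4 → Fin 4 → ℝ := fun x y => !![0, 4, 4, 0; 0, 0, 0, 4; 0, 0, 0, 4; 0, 0, 0, 0] x y

/-- LEFT multiplication by the quaternion `u = (u₀, u₁, u₂, u₃)` on ℍ = ℝ⁴ (basis 1, i, j, k) — the E3 lane's link action `Lq`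
(orthogonal when `|u| = 1`). [folklore] -/
def Lq (u : Fin 4 → ℝ) : Matrix (Fin 4) (Fin 4) ℝ :=
  !![u 0, -u 1, -u 2, -u 3; u 1, u 0, -u 3, u 2; u 2, u 3, u 0, -u 1; u 3, -u 2, u 1, u 0]

/-- link variables in the corner-taxi tree gauge: the free link `u` sits on the bond `(1,3) = ((0,1) → (1,1))`, every other pair carries the
identity. [cite: Balaban1983RegularityDecay, p. 572 (1.3)] -/
def WL2 (u : Fin 4 → ℝ) : Fin 4 → Fin 4 → Matrix (Fin 4) (Fin 4) ℝ :=
  fun x y => if x = 1 ∧ y = 3 then Lq u else 1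

/-- block-averaging weights `q(y,x) = η^d = 1/4` (one coarse site). [cite: Balaban1983RegularityDecay, p. 572 (1.4)] -/
def qL2 : Unit → Fin 4 → ℝ := fun _ _ => 1 / 4

/-- transporters to the block corner along the taxi tree: identity in tree gauge. [cite: Balaban1983RegularityDecay, p. 572 (1.4)] -/
def TL2 : Unit → Fin 4 → Matrix (Fin 4) (Fin 4) ℝ := fun _ _ => 1

/-- the lane's packing of the free link: `u i = X i`, `i < 4`. [folklore] -/
def linkOf (X : ℕ → ℝ) : Fin 4 → ℝ := fun i => X i

/-- the lane's packing of the test field: `Φ (s, c) = X (4 + 4s + c)`. [folklore] -/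
def fieldOf (X : ℕ → ℝ) : Fin 4 × Fin 4 → ℝ := fun p => X (4 + 4 * (p.1 : ℕ) + (p.2 : ℕ))

/-! ## §2 The dictionary identity -/

/-- the bond-weight table has exactly four nonzero entries. [folklore] -/
theorem sum_cL2 (f : Fin 4 → Fin 4 → ℝ) :
    ∑ x, ∑ y, cL2 x y * f x y = 4 * f 0 1 + 4 * f 0 2 + 4 * f 1 3 + 4 * f 2 3 := by
  simp only [Fin.sum_univ_four, cL2, Fin.isValue, Matrix.of_apply, Matrix.cons_val', Matrix.cons_val_zero, Matrix.cons_val_one,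
    Matrix.empty_val', Matrix.cons_val_fin_one, Matrix.cons_val]
  norm_num

/-- the tree bonds carry the identity. [folklore] -/
theorem WL2_tree (u : Fin 4 → ℝ) : WL2 u 0 1 = 1 ∧ WL2 u 0 2 = 1 ∧ WL2 u 2 3 = 1 := by
  refine ⟨?_, ?_, ?_⟩ <;> simp [WL2]

/-- the free bond carries `Lq u`. [folklore] -/
theorem WL2_free (u : Fin 4 → ℝ) : WL2 u 1 3 = Lq u := by simp [WL2]

/-- the squared norm of a covariant bond difference across a TREE bond, in coordinates. [folklore] -/
theorem tree_term (Φ : Fin 4 × Fin 4 → ℝ) (x y : Fin 4) :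
    (((1 : Matrix (Fin 4) (Fin 4) ℝ) *ᵥ fld Φ y - fld Φ x) ⬝ᵥ ((1 : Matrix (Fin 4) (Fin 4) ℝ) *ᵥ fld Φ y - fld Φ x)) =
      (Φ (y, 0) - Φ (x, 0)) ^ 2 + (Φ (y, 1) - Φ (x, 1)) ^ 2 + (Φ (y, 2) - Φ (x, 2)) ^ 2 + (Φ (y, 3) - Φ (x, 3)) ^ 2 := by
  simp only [Matrix.one_mulVec, dotProduct, Fin.sum_univ_four, Pi.sub_apply, fld_apply, Fin.isValue]
  ring

/-- the squared norm of the covariant bond difference across the FREE bond, in coordinates (left quaternion multiplication). [folklore] -/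
theorem free_term (u : Fin 4 → ℝ) (Φ : Fin 4 × Fin 4 → ℝ) (x y : Fin 4) :
    ((Lq u *ᵥ fld Φ y - fld Φ x) ⬝ᵥ (Lq u *ᵥ fld Φ y - fld Φ x)) =
      (u 0 * Φ (y, 0) - u 1 * Φ (y, 1) - u 2 * Φ (y, 2) - u 3 * Φ (y, 3) - Φ (x, 0)) ^ 2 +
      (u 1 * Φ (y, 0) + u 0 * Φ (y, 1) - u 3 * Φ (y, 2) + u 2 * Φ (y, 3) - Φ (x, 1)) ^ 2 +
      (u 2 * Φ (y, 0) + u 3 * Φ (y, 1) + u 0 * Φ (y, 2) - u 1 * Φ (y, 3) - Φ (x, 2)) ^ 2 +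
      (u 3 * Φ (y, 0) - u 2 * Φ (y, 1) + u 1 * Φ (y, 2) + u 0 * Φ (y, 3) - Φ (x, 3)) ^ 2 := by
  simp only [Lq, Matrix.mulVec, dotProduct, Fin.sum_univ_four, Pi.sub_apply, fld_apply, Fin.isValue, Matrix.of_apply,
    Matrix.cons_val', Matrix.cons_val_zero, Matrix.cons_val_one, Matrix.empty_val', Matrix.cons_val_fin_one, Matrix.cons_val]
  ring

/-- the block average squared, in coordinates. [folklore] -/
theorem avg_term (Φ : Fin 4 × Fin 4 → ℝ) :
    (avgOp qL2 TL2 *ᵥ Φ) ⬝ᵥ (avgOp qL2 TL2 *ᵥ Φ) =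
      ∑ i : Fin 4, ((1 / 4 : ℝ) * (Φ (0, i) + Φ (1, i) + Φ (2, i) + Φ (3, i))) ^ 2 := by
  have hA : ∀ i : Fin 4, (avgOp qL2 TL2 *ᵥ Φ) ((), i) = (1 / 4 : ℝ) * (Φ (0, i) + Φ (1, i) + Φ (2, i) + Φ (3, i)) := by
    intro i
    have h := congrFun (fld_avgOp_mulVec qL2 TL2 Φ ()) i
    simp only [fld_apply] at h
    rw [h]
    simp only [qL2, TL2, Matrix.one_mulVec, Finset.sum_apply, Pi.smul_apply, smul_eq_mul, Fin.sum_univ_four, fld_apply,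
      Fin.isValue]
    ring
  rw [dotProduct, Fintype.sum_prod_type, Finset.univ_unique, Finset.sum_singleton]
  refine Finset.sum_congr rfl fun i _ => ?_
  rw [show (default : Unit) = () from rfl, hA i, sq]

/-- **THE TREE OPERATOR'S QUADRATIC FORM IN COORDINATES** on the (2,2,1) block. [cite: Balaban1983RegularityDecay, p. 572 (1.3)–(1.6)] -/
theorem covOp_form_L2d2 (u : Fin 4 → ℝ) (Φ : Fin 4 × Fin 4 → ℝ) :
    Φ ⬝ᵥ (covOp cL2 0 4 qL2 (WL2 u) TL2 *ᵥ Φ) =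
      4 * (((1 : Matrix (Fin 4) (Fin 4) ℝ) *ᵥ fld Φ 1 - fld Φ 0) ⬝ᵥ ((1 : Matrix (Fin 4) (Fin 4) ℝ) *ᵥ fld Φ 1 - fld Φ 0)) +
      4 * (((1 : Matrix (Fin 4) (Fin 4) ℝ) *ᵥ fld Φ 2 - fld Φ 0) ⬝ᵥ ((1 : Matrix (Fin 4) (Fin 4) ℝ) *ᵥ fld Φ 2 - fld Φ 0)) +
      4 * ((Lq u *ᵥ fld Φ 3 - fld Φ 1) ⬝ᵥ (Lq u *ᵥ fld Φ 3 - fld Φ 1)) +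
      4 * (((1 : Matrix (Fin 4) (Fin 4) ℝ) *ᵥ fld Φ 3 - fld Φ 2) ⬝ᵥ ((1 : Matrix (Fin 4) (Fin 4) ℝ) *ᵥ fld Φ 3 - fld Φ 2)) +
      4 * ((avgOp qL2 TL2 *ᵥ Φ) ⬝ᵥ (avgOp qL2 TL2 *ᵥ Φ)) := by
  rw [covOp, Matrix.add_mulVec, Matrix.add_mulVec, dotProduct_add, dotProduct_add, covLap_form, zero_smul,
    Matrix.zero_mulVec, dotProduct_zero, add_zero, Matrix.smul_mulVec, dotProduct_smul, projOp_form, smul_eq_mul,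
    sum_cL2, (WL2_tree u).1, (WL2_tree u).2.1, (WL2_tree u).2.2, WL2_free]

set_option maxRecDepth 16384 in
/-- **THE LANE POLYNOMIAL IS THE TREE OPERATOR'S QUADRATIC FORM**: `Poly.eval X zL2d2AllU_quadH = 2²⁰ · ⟨Φ, (covLap cL2 (WL2 u) + 0·1 + 4·projOp qL2 TL2) Φ⟩`
with `u = linkOf X`, `Φ = fieldOf X`, for every real `X`. [cite: Balaban1983RegularityDecay, p. 572 (1.3)–(1.6)] -/
theorem quadH_eq_covOp_form (X : ℕ → ℝ) :
    Poly.eval X zL2d2AllU.quadH =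
      2 ^ 20 * (fieldOf X ⬝ᵥ (covOp cL2 0 4 qL2 (WL2 (linkOf X)) TL2 *ᵥ fieldOf X)) := by
  rw [covOp_form_L2d2, tree_term, tree_term, tree_term, free_term, avg_term]
  have hL : Poly.eval X zL2d2AllU.quadH = Poly.eval X zL2d2AllU_quadH := rfl
  rw [hL]
  simp only [zL2d2AllU_quadH, Poly.eval, Poly.evalMono, Int.cast_negSucc, pow_one, Fin.sum_univ_four, fieldOf, linkOf,
    Fin.isValue, Fin.val_zero, Fin.val_one]
  norm_num
  ring

/-! ## §3 The certificate in tree currency -/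

/-- the sphere constraint of the lane (`|x_t|² − 1 = 0` for the one free link) holds when `u` is a unit quaternion. [folklore] -/
theorem sphere_of_unit (X : ℕ → ℝ) (hu : (X 0) ^ 2 + (X 1) ^ 2 + (X 2) ^ 2 + (X 3) ^ 2 = 1) :
    ∀ ew ∈ zL2d2AllU.eq, Poly.eval X ew.1 = 0 := by
  intro ew hew
  simp only [zL2d2AllU, zL2d2AllU_eqs, List.mem_singleton] at hew
  subst hew
  simp only [zL2d2AllU_e0, Poly.eval, Poly.evalMono]
  push_cast
  nlinarith [hu]

/-- the lane's `Σ v²` polynomial is `Φ ⬝ᵥ Φ`. [folklore] -/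
theorem vSq_eq (X : ℕ → ℝ) :
    Poly.eval X ((List.range zL2d2AllU.dim).map (fun i => ([(zL2d2AllU.nx + i, 2)], (1 : ℤ)))) = fieldOf X ⬝ᵥ fieldOf X := by
  simp only [zL2d2AllU, dotProduct, Fintype.sum_prod_type, Fin.sum_univ_four, fieldOf, List.range, List.range.loop, List.map,
    Poly.eval, Poly.evalMono, Fin.isValue]
  norm_num
  ring

/-- **[B4] (1.8)-SHAPE COERCIVITY ON THE (2,2,1) BLOCK FOR EVERY SU(2) LINK, IN TREE CURRENCY** (kernel certificate `E3Z.zL2d2AllU_nonneg` read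
through the dictionary): for every unit quaternion `u = (X 0,…,X 3)` and every ℍ-valued field `Φ = fieldOf X` on the four sites,
`(1021/1024)·(Φ ⬝ᵥ Φ) ≤ Φ ⬝ᵥ (covOp cL2 0 4 qL2 (WL2 u) TL2 *ᵥ Φ)`, i.e. `−Δ_W + 4P ≥ (1021/1024)·1 ≥ (499/500)·a` with `a = 1` on this block
(tree gauge; every gauge orbit meets it, `B4GaugeCovariance.covLap_gauge`).  Certified computation, d = 2; NOT Prop. (1.8).
[cite: Balaban1983RegularityDecay, p. 573 (1.8)] -/
theorem covOp_coercive_L2d2 (X : ℕ → ℝ) (hu : (X 0) ^ 2 + (X 1) ^ 2 + (X 2) ^ 2 + (X 3) ^ 2 = 1) :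
    (1021 / 1024 : ℝ) * (fieldOf X ⬝ᵥ fieldOf X) ≤
      fieldOf X ⬝ᵥ (covOp cL2 0 4 qL2 (WL2 (linkOf X)) TL2 *ᵥ fieldOf X) := by
  have h := zL2d2AllU_nonneg X (sphere_of_unit X hu) (by simp [zL2d2AllU])
  rw [vSq_eq] at h
  have hq := quadH_eq_covOp_form X
  have hM : (zL2d2AllU.gamma : ℝ) = 1045504 := by norm_num [zL2d2AllU]
  rw [hM, hq] at h
  nlinarith [h]

end

end Summit.QuantumFields.BalabanUV.Gaps.E3BlockL2d2Dictionary
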